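import Mathlib
import HarnessLib
import HarnessLib.Audit
import Summits.Langlands.Statement

/-!
Route: EvenArtinGL4Door

DORMANT since 2026-09-03T10:52:54Z (reconciler: no traction for 5 d (last activity statement-checked at 2026-08-29T09:42:52Z); parked, not closed — `ledger route dormant route-Langlands-EvenArtinGL4Door --off` to reactivate) — unstaffed, not closed; items shared with open routes are served there. `ledger route dormant <id> --off` reactivates.

# Route EvenArtinGL4Door — even icosahedral rho through the (2,2)-door — mod-2 residual automorphy,
2-adic pro-automorphy of rho tensor theta_psi on GL4/Q, classicality at weight -rho, multi-door
descent

X (the even-Artin sector of direction (B) for n = 2, F = ℚ): every continuous irreducible ρ : Γ_ℚ →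
GL₂(ℂ) of ICOSAHEDRAL type
which is EVEN (det ρ(c) = +1) has a cuspidal automorphic representation π of GL₂(𝔸_ℚ) with π_v =
π(ρ_v) at all but finitely many
places (Tunnell's sense: Satake parameter = arithmetic Frobenius a.e.). This is the one Artin
case over ℚ in rank 2 with no engine at all: solvable types of either parity are Langlands–Tunnell,
odd icosahedral is
Khare–Wintenberger + Kisin. Realises card even-artin-gl4-door (spine). X → Langlands is the support
item EvenArtinJunction (the rest
of the summit: other n, other F, direction (A), the upgrade of a.e. Satake–Frobenius matching to
`Corresponds`), so this is a
SECTOR route.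
Lean: `∀ ρ : Literature.NumberTheory.GaloisRepresentations.FramedGaloisRep ℚ ℂ 2,
ρ.toGaloisRep.IsIrreducible → Nonempty ((Matrix.ProjGenLinGroup.mk.comp ρ.toMonoidHom).range ≃*
alternatingGroup (Fin 5)) → (∀ (φ : ℚ →+* ℝ) (c : Field.absoluteGaloisGroup ℚ),
Literature.NumberTheory.GaloisRepresentations.IsComplexConjugation φ c →
Matrix.GeneralLinearGroup.det (ρ c) = 1) → ∃ (hcpt :
Literature.NumberTheory.Automorphic.isCompact_glFiniteIntegralLevel 2 ℚ) (π :
Literature.NumberTheory.Automorphic.CuspidalAutomorphicRepData 2 ℚ hcpt), (∀ᶠ v :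
IsDedekindDomain.HeightOneSpectrum (NumberField.RingOfIntegers ℚ) in Filter.cofinite, ∃ α : Multiset
ℂ, π.1.HasSatakeParamAt v α ∧ ρ.IsUnramifiedAt v ∧ ρ.HasFrobCharpolyAt v
(Literature.NumberTheory.Automorphic.satakePolynomial α))`

TYPING (route-repair 2026-08-15, cone hygiene). Every item is typed over the cone of
`Summits.Langlands.Statement` ALONE (route
imports: no Literature module beyond the Statement's own). The Artin vocabulary of the card is
unfolded definitionally (checked by
`Iff.rfl` against the Literature decls, Equiv.lean rc 0): `FramedArtinRep ℚ n` = `FramedGaloisRep ℚ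
ℂ n`; `IsIcosahedralType
ρ.toMonoidHom` = `Nonempty ((Matrix.ProjGenLinGroup.mk.comp ρ.toMonoidHom).range ≃* alternatingGroup
(Fin 5))`; `IsPiOfArtinRep ρ π.1`
= `∀ᶠ v in cofinite, ∃ α, π.1.HasSatakeParamAt v α ∧ ρ.IsUnramifiedAt v ∧ ρ.HasFrobCharpolyAt v
(satakePolynomial α)`; "R is a
framed model of Ind_L^ℚ(ρ|_L ⊗ ψ)" = the explicit `Representation.ind (absGaloisRestrict ℚ
L).toMonoidHom σ.toGaloisRep.toRepresentation`
clause with σ = ψ • ρ|_L entrywise; "residually automorphic mod 2 / 2-adic limit to precision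
2^(−s)" = coefficientwise
‖ι⁻¹(charpoly R(Frob_v)) − arithFrobPolyOfSatake ι q_v 4 α‖ < 1, resp. ≤ (1/2)^s, in ℚ̄₂, at almost
all v. The 34 unproved named
facts of the four former imports (StrongArtinGL2, ArtinFormalism, ProjectiveType,
PadicComplexEmbedding: newform / ERH /
Langlands–Tunnell / Deligne–Serre / Artin-conductor facts) were hypotheses of NO item and are gone
from the cone; needs-fact: none.

## Assembly
DECIDING THEOREM (D-0027 §2.1; proved sorry-free, axioms propext / Classical.choice / Quot.sound):
`theorem closes :
ResidualDoorMod2 → TwoAdicProAutomorphyGL4 → ArtinLimitClassicalityGL4 → RealQuadraticDoorDescent →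
EvenArtinJunction → Langlands`.
Proof (pure logic): an abstract field isomorphism ι : ℚ̄₂ ≃+* ℂ exists (both algebraically closed of
characteristic 0 and
cardinality 𝔠; proved inline from Mathlib, `IsAlgClosed.ringEquiv_of_equiv_of_charZero`);
EvenArtinJunction reduces the summit to
X; given an even irreducible icosahedral ρ, RealQuadraticDoorDescent asks, for every real quadratic
L with odd discriminant, for door
data (ψ, R) and a cuspidal Π on GL₄(𝔸_ℚ) matching R a.e.; ResidualDoorMod2 supplies (ψ, R) with R
irreducible and residually
automorphic mod 2 in regular weight, TwoAdicProAutomorphyGL4 makes R a 2-adic limit of regular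
algebraic cuspidal Π_s of GL₄(𝔸_ℚ),
ArtinLimitClassicalityGL4 turns the limit into Π. The evenness hypothesis is not consumed by the
cruxes (they hold for either
parity; parity dies mod 2). The item `Assembly` (the same implication as a Prop) is kept as
bookkeeping; it is proved by the same
term (evidence Sketch.lean, `assembly_holds`).

Rationale: WHY THIS LINE. Mechanism of card even-artin-gl4-door, sharpened while typing it. (1) PARITY DIES MOD
2: det ρ̄₂(c) = −1 = +1, so Serre's conjecture at
p = 2 (KhareWintenberger2009 + Kisin doi:10.1007/s00222-009-0207-5; tree:
`exists_newform_of_odd_irreducible`, oddness provable in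
char 2) makes ρ̄₂ (image SL₂(F₄) ≅ A₅) modular. (2) PARITY MERGES AFTER INDUCTION: for L real
quadratic and ψ a finite-order character of
Γ_L of MIXED signature, R := Ind_L^ℚ(ρ|_L ⊗ ψ) ≅ ρ ⊗ θ_ψ is irreducible with tr R(c) = ψ(c₁)·2 +
ψ(c₂)·2 = 0, i.e. c ↦ diag(1,1,−1,−1):
odd in the GL₄ sense (|tr c| ≤ 1, Caraiani–Le Hung arXiv:1409.2158; Hansen–Newton arXiv:1412.1533
Conj. 1.2.2). New observation: R is
ESSENTIALLY SELF-DUAL both ways through hyperbolic forms on Ind — symplectic with multiplier of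
parity −1 (GSp₄-odd, the parity of
abelian surfaces; Caraiani–Le Hung arXiv:1409.2158 for the automorphic side) and orthogonal with
multiplier of parity −1 (GO₄-EVEN) — while the REGULAR-weight automorphic lifts of R̄₂ that present
technology supplies are
non-polarisable (AI(g), g a Hilbert eigenform over L of non-parallel weight ≡ BC_L(f) ⊗ ψ mod 2: HT
weights {0,1,k,k+1}) or GO₄-ODD
(f ⊠ θ_ψ, Ramakrishnan doi:10.2307/2661379); the two parity classes of polarised deformation rings
meet only in the UNPOLARISED
deformation space of R̄₂ over ℚ, whose expected dimension 1 + h¹ − h² = 1 + (1 + 16 − 8) = 10 equals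
the Calegari–Emerton dimension
1 + dim B − l₀ = 1 + 10 − 1 of the big Hecke algebra of completed cohomology of GL₄/ℚ
(CalegariGeraghty2017 §1; Gee–Newton
arXiv:1609.06965). That is why the door is GL₄/ℚ completed cohomology and nothing smaller. (3) Crux
TwoAdicProAutomorphyGL4 types
"R is a point of Spf T(K^2)_m" in its characteristic-0 shadow: R is a 2-adic limit, in Frobenius
characteristic polynomials, of regular
algebraic cuspidal Π_s of GL₄(𝔸_ℚ) — the output of 'big R = T at m' plus 2-adic accumulation of the
(conjectural) ordinary GSp₄ family at
x_R. (4) Crux ArtinLimitClassicalityGL4 isolates the archimedean realisation at the most singular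
weight −ρ (all 24 refinements
companion to each other) — the residue of NonRegularWeightBarrier stated over ℚ, shared verbatim
with the mixed-signature-field and
Hodge–Tate-multiplicity ≥ 3 sectors. (5) Crux RealQuadraticDoorDescent is new glue: ONE door
recovers π(ρ) only up to sign flips at
split primes (conservation of difficulty: mixed signature forces ψ^{τ−1} of even order), but doors
for infinitely many L plus
Arthur–Clozel AI-fibres (ArthurClozelAMS120 Ch. 3 Thm 4.2 (b),(d), 3.1), the Rankin–Selberg pole
calculus (JacquetShalika1981, Shahidi)
against the KNOWN Galois side ord_{s=1} L(s, Artin) = −mult(1), and Ramakrishnan's multiplicity one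
for SL(2) (doi:10.2307/2661379 Thm
4.1.2: ad(π) ≅ ad(π') ⇒ π' ≅ π ⊗ χ) pin π exactly. Areas imported: p-adic automorphic forms / Galois
deformations (completed
cohomology, patching), automorphic L-functions (isobaric rigidity), real representation theory
(Knapp–Zuckerman degenerate limits).
Not used: analytic conditionals (Selberg eigenvalue/orthonormality — card
selberg-orthonormality-bridge), CM-field corners (cards
even-icosahedral-p3-cm-corner, parity-blind-prime-two-even-artin: there R has no regular residual
lift), coherent U(2,2)/Hermitian doors
(retired cards: degenerate limit, as (4) explains).

RANKED CRUXES. #0 EvenIcosahedralStrongArtin (target) — strong Artin in Tunnell's a.e. sense for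
every irreducible even icosahedral ρ : Γ_ℚ → GL₂(ℂ): ∃ cuspidal π on GL₂(𝔸_ℚ) with `IsPiOfArtinRep ρ
π`. (why it might fail: False only if Langlands (B) fails for an even icosahedral ρ/ℚ. No engine
exists: insoluble image (no base change), det ρ(c)=+1 (no weight-one/coherent door), Maass
eigenvalue 1/4 (no Betti cohomology): Calegari 2109.14145 §12 'no progress'.) [Calegari2023,
BuzzardGeeLMS2014, Gelbart1997, doi:10.1016/j.jnt.2005.08.008]
#2 TwoAdicProAutomorphyGL4 (crux) — (card crux α, typed as its characteristic-0 shadow) Let ρ : Γ_ℚ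
→ GL₂(ℂ) be irreducible, L real quadratic with 2 ∤ disc L, ψ : Γ_L → ℂ× of finite order and mixed
signature such that no ψ^(2^a) is the restriction of a character of Γ_ℚ, and R : Γ_ℚ → GL₄(ℂ) a
framed model of Ind_L^ℚ(ρ|_L ⊗ ψ), irreducible. If R is residually automorphic mod 2 in regular
weight — some regular algebraic cuspidal Π₀ of GL₄(𝔸_ℚ) has ι⁻¹(arithmetic-Frobenius polynomial of
r_ι(Π₀)) ≡ ι⁻¹(charpoly R(Frob_v)) coefficientwise modulo the maximal ideal of ℤ̄₂ at almost all v —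
then R is a 2-ADIC LIMIT of regular algebraic cuspidal representations: for every s there is a
regular algebraic cuspidal Π_s of GL₄(𝔸_ℚ) with the same congruence to precision 2^(−s) at almost
all v. Informal content: big R^(unpolarised) = T(K^2)_m for GL₄/ℚ at m = m_(R̄₂) (Hansen–Newton
Conj. 1.2.3 at this m; Gee–Newton's conditional theorem made unconditional here) + 2-adic
accumulation of regular de Rham points at the Artin point x_R (expected through the ordinary GSp₄
family: R is symplectic-odd and ordinary at every ℓ ∤ cond R). [difficulty: open-problem] (why it
might fail: l₀(GL₄/ℚ)=1: big R=T is conjectural (Gee–Newton conditional); p=2 with image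
SL₂(F₄)⊗dihedral may fail adequacy; R is GSp₄-odd while the known regular residual lifts (AI(g),
f⊠θ_ψ) are non-polarisable or GO₄-odd, so regular classical points may be 2-adically isolated from
x_R (Ash–Pollack–Stevens).) [arXiv:1412.1533, arXiv:1609.06965, doi:10.1112/plms/pdm048,
arXiv:0708.2451, CalegariGeraghty2017, arXiv:1604.07739, arXiv:2206.06944]
#3 ArtinLimitClassicalityGL4 (crux) — (card crux β: archimedean realisation at weight −ρ) every
irreducible Artin representation R : Γ_ℚ → GL₄(ℂ) that is a 2-adic limit of regular algebraic
cuspidal representations of GL₄(𝔸_ℚ) (in the sense of crux 2) corresponds a.e. to an L-algebraic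
cuspidal automorphic representation Π of GL₄(𝔸_ℚ): `IsPiOfArtinRep R Π`. A special case of
Fontaine–Mazur–Langlands for n = 4 with the extra hypothesis 'pro-automorphic'; the expected Π_∞ is
tempered with parameter 1⊕1⊕sgn⊕sgn (infinitesimal character 0). [deps: TwoAdicProAutomorphyGL4]
[difficulty: open-problem] (why it might fail: No mechanism at weight −ρ: Verma module simple (no
Coleman/Ash–Stevens classicality); 1⊕1⊕sgn⊕sgn is a DEGENERATE limit of discrete series on GSp₄,
U(2,2) (Knapp–Zuckerman), so no coherent door; sole precedent (Buzzard–Taylor weight one) is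
coherent. True under Fontaine–Mazur–Langlands.) [FontaineMazurGeometric1995, BuzzardGeeLMS2014,
Calegari2023, BorelWallach2000, arXiv:1412.1533, doi:10.2307/121076, Knapp–Zuckerman Ann. of Math.
116 (1982) 389–501]
#4 RealQuadraticDoorDescent (crux) — (card bookkeeping δ, upgraded) Let ρ be irreducible of
icosahedral type. Suppose that for EVERY real quadratic L with 2 ∤ disc L there are ψ (finite order,
mixed signature, no ψ^(2^a) descending to ℚ), a framed model R of Ind_L^ℚ(ρ|_L ⊗ ψ) and a cuspidal Π
on GL₄(𝔸_ℚ) with `IsPiOfArtinRep R Π`. Then ∃ cuspidal π on GL₂(𝔸_ℚ) with `IsPiOfArtinRep ρ π`.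
Sketch: Π ≅ Π ⊗ χ_L (SMO) ⇒ Π = AI(Π_L) (AC 4.2(b)); the Rankin–Selberg L-function of BC_L(Π)
against BC_L(Π) ⊗ ψ^(1−τ) has Galois-side pole order exactly 1 (Artin: ord_(s=1) = −mult(1); needs
ψ² not from ℚ), forcing exactly one of Π_L ψ⁻¹, Π_L^τ ψ⁻¹ to be τ-invariant, hence = BC_L(π^(L)) for
a cuspidal π^(L) on GL₂(𝔸_ℚ) (AC 4.2(d)); a priori Sat(π^(L)_p) = eigenvalues of ρ(Frob_p) only up
to signs (common signs at split p, independent at inert p); ω_(π^(L)) = det ρ is forced by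
Rankin–Selberg orthogonality for Sym² π^(L) (Chebotarev average of |a²+b²+ab ξ(p)|² is 3 for an
impostor ξ ≠ 1 versus the mandatory 1), so all sign defects are common and ad(π^(L)) ↔ ad⁰ρ EXACTLY
(Gelbart–Jacquet, SMO on GL₃); hence all π^(L) are twists of one π₀ (Ramakrishnan SL(2) multiplicity
one); the sign defect of π₀ is then constant on the inert primes of each admissible L, hence
constant on {p : tr ρ(Frob_p) ≠ 0} (any two primes are simultaneously inert in some admissible L),
and the value −1 is excluded by Chebotarev in M·L(ψ); so `IsPiOfArtinRep ρ π₀`. [difficulty: L] (why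
it might fail: One door pins π only up to signs ε_p at split p with ψ^{τ−1}(Frob_w)=−1 (forced:
mixed signature ⇒ ψ^{τ−1} of even order). Sketch needs doors for infinitely many L, AC Thm
4.2(b)(d), JS/Shahidi poles, ord_{s=1} of Artin L, Ramakrishnan SL(2) multiplicity one; not in
print.) [ArthurClozelAMS120, doi:10.2307/2661379, doi:10.1155/s1073792802000016,
LanglandsBaseChange1980, JacquetShalika1981, Gelbart1997]
#9 ResidualDoorMod2 (support) — (card item γ, the residual engine; theorem-sized) for ρ irreducible
icosahedral, every ι : ℚ̄₂ ≃ ℂ and every real quadratic L with 2 ∤ disc L there are ψ and R as in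
crux 2 with R irreducible, tr R(c) = 0 at complex conjugations, and R residually automorphic mod 2
from a REGULAR algebraic cuspidal Π₀ of GL₄(𝔸_ℚ). Proof plan: f from KW at p = 2 (ρ̄₂ ≅ ρ̄_f, image
SL₂(F₄)); ψ = ψ_sgn·ψ_odd with ψ_odd of odd order ramified at exactly one of a split pair q = 𝔮𝔮^τ
(so ψ̄^τ ≠ ψ̄ and R̄₂ = Ind(ρ̄_f|_L ⊗ ψ̄) is absolutely irreducible by Mackey) and ψ_sgn of mixed
signature (exists for every L: kill unit obstructions with a large modulus); g = characteristic-0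
Hilbert eigenform over L of paritious non-parallel weight (k+2, k), k ≥ 2, congruent mod 2 to
BC_L(f) ⊗ ψ (partial Hasse invariants, 2 unramified in L: Andreatta–Goren; Deligne–Serre lifting);
Π₀ := AI_L^ℚ(g) is cuspidal (g ≄ g^τ), regular algebraic (HT {0,1,k,k+1}) and r̄_ι(Π₀) ≅ R̄₂.
[difficulty: L] [KhareWintenberger2009, doi:10.1007/s00222-009-0207-5, DeligneSerreASENS1974,
ArthurClozelAMS120, doi:10.1090/memo/0819, arXiv:1405.6349, HarrisLanTaylorThorneRMS2016]
#9 EvenArtinJunction (support) — X → Langlands: the rest of the summit (regular / totally-real–CM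
sectors, other n and F, direction (A), and the upgrade of the a.e. `IsPiOfArtinRep` to `Corresponds`
at every finite place by local–global compatibility + strong multiplicity one). Not this route's
business; filed so that the Assembly ends in the summit constant; shared junction for every
even-Artin card. [difficulty: open-problem] [BuzzardGeeLMS2014, FontaineMazurGeometric1995]

TWO-LAYER PLAN. Foreseen glued splits (k ≤ 3, depth 1), filed only when a crux moves:
TwoAdicProAutomorphyGL4 ⇐ BigRTUnpolarisedGL4 (R_(R̄₂,S) → T(K^2)_m
iso modulo nilpotents; needs the definition requests) → OrdinaryGSp4FamilyAtArtinPoint (x_R lies on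
a finite flat 2-adic ordinary GSp₄
family; classical regular points accumulate) → C1. ArtinLimitClassicalityGL4 ⇐
LimitIsOrdinarySymplectic → SingularWeightClassicalityGSp4
(higher Hida theory in degree 1 at the weight of HT (0,0,0,0)) → C2. RealQuadraticDoorDescent ⇐
SingleDoorUpToSigns → MultiDoorRigidity → C3.
A parallel p odd variant of C1 (friendly patching, residual automorphy of Ind(even ⊗ ψ̄) mod p open)
is a separate route sharing C2, C3.

KILL CRITERIA. C1 refuted for one admissible (ρ, L, ψ) — e.g. a proof that x_R is 2-adically
isolated from regular de Rham points of the unpolarised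
deformation space, or the torsion computation of the Cheapest falsifier coming back empty at all
accessible depths — closes the route
`refuted:TwoAdicProAutomorphyGL4` unless the torsion (pro-automorphic) formulation survives, in
which case pivot: restate C1 over the
definition requests and weaken C2 accordingly. C2 can only be refuted together with Langlands (B)
for n = 4; a refutation is a summit
event. C3 refuted (impossible without refuting Langlands for ρ) — n/a; C3 proved EXHAUSTED ⇒ replace
by Ramakrishnan's Prop 7.9-style
common descent over infinitely many quadratic fields. Target proved elsewhere
(selberg-orthonormality-bridge, kronecker-rigidity cards)
moots the route; C1+C2 then remain as the GL₄ p-adic statements of independent interest.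

NOT DECOMPOSED YET. The torsion/pro-automorphic form of C1 (needs completed cohomology of GL_n/ℚ,
Scholze–Johansson–Newton determinants over T(K^p): definition
requests below); the choice of (L, ψ) optimising adequacy of R̄₂(Γ_ℚ(ζ₄)) at p = 2; the odd-p
variant; local–global compatibility at
ramified places and the `Corresponds` upgrade (junction side); the GSp₄ reformulation of C1/C2 (R is
symplectic-odd); the Hilbert-modular
weight-shifting lemma at 2 (inside ResidualDoorMod2); constants in the multi-door Chebotarev step of
C3.

CHEAPEST FALSIFIER. (a) Torsion probe of C1 (card's refutation (b)): for a prime-conductor even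
icosahedral ρ of Doud–Moore (doi:10.1016/j.jnt.2005.08.008),
L = ℚ(√5), ψ of order 6 and odd conductor, compute the Hecke eigensystem of R = ρ ⊗ θ_ψ and search
for it mod 4 and mod 8 in
H⁵(Γ₁(N·25·f_ψ) ⊂ SL₄(ℤ); ℤ/2^m) à la Ash–Gunnells–McConnell (arXiv:1002.3385): present mod 2 (it
must be, by ResidualDoorMod2) but
absent mod 4 at every computable level is evidence against C1 (kit job, not yet run: hub
compute-free this session, searchd down).
(b) Finite-group check (kit gap): is R̄₂(Γ_ℚ(i)) ⊂ GL₄(F̄₂), image (SL₂(F₄) ⊗ μ₃-dihedral), adequate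
/ generic in ANY published
sense at p = 2? If no variant survives, C1 must move to odd p and loses its free residual
automorphy. (c) Typing sanity: C1 for ODD
SOLVABLE ρ is provable now (Hida families of π(ρ) and θ_ψ, products f_k ⊠ θ_k'); if that fails in
the filed normalisation
(`arithFrobPolyOfSatake ι q 4 α` vs `HasFrobCharpolyAt`), the signature is mis-typed —
set-signature, not closure.

NUMBERS. Unpolarised deformations of R̄₂ over ℚ: 1 + h¹ − h² = 1 + h⁰ + n² − dim (ad)^c = 1 + 1 + 16
− (2² + 2²) = 10; Hecke side 1 + dim B(GL₄) − l₀
= 1 + 10 − 1 = 10 (det fixed: 9 = 9); even ρ on GL₂/ℚ: 1 + 1 + 4 − 4 = 2 < 4 (deficient: why even ρ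
is invisible to the eigencurve);
l₀(GL₄/ℚ) = ⌈4/2⌉ − 1 = 1, q₀ = 4, cuspidal range [4,5] of the 9-dimensional locally symmetric
space; signature of R(c) = (2,2), tr = 0;
A₅ has 15/60 involutions ⇒ density 1/4 of p with tr ρ(Frob_p) = 0; HT weights of AI(g), g of weight
(k+2,k): {0,1,k,k+1}, regular iff
k ≥ 2; refinements at the Artin point: 4! = 24, all ordinary (Frobenius eigenvalues roots of unity)
at ℓ ∤ cond R. Items at open: 7
(1 target, 3 cruxes, 2 support, 1 assembly).

DEFINITION REQUESTS. To be filed after open (`ledger workitem add --kind definition`):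
CompletedCohomologyHeckeGLn (T(K^p)_m of H̃^•(GL_n/ℚ, K^p) with its
spherical Hecke action; Calegari–Emerton), HeckeDeterminantGLn (the n-dimensional determinant Γ_ℚ →
T(K^p)_m/I, Scholze2015 Cor. V.4.2 /
Johansson–Newton arXiv:1604.07739 Thm B), TorsionHeckeEigenclass (Hecke eigen-systems in H^i(Γ₁(N) ⊂
SL_n(ℤ), ℤ/p^m), for the torsion
form of C1 and falsifier (a)). Cite facts wanted (named facts, hypotheses of C3/ResidualDoorMod2
proofs): Ramakrishnan GL₂ × GL₂ → GL₄
and multiplicity one for SL(2) (doi:10.2307/2661379 Thm M, Thm 4.1.2); JPSS/Shahidi: L(s, Π × Π')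
for cuspidal GL₄ × GL₄ has a pole at
s = 1 iff Π' ≅ Π^∨-dual pair, entire for GL₄ × GL₂, non-vanishing on Re s = 1; Gelbart–Jacquet Sym²;
ord_(s=1) of Artin L-functions =
−⟨χ,1⟩ (Brauer + Hecke; tree has non-vanishing pieces in ArtinLFunctionNonvanishingProofs); Galois
representations of Hilbert eigenforms
and of AI(g) (HarrisLanTaylorThorneRMS2016 covers regular algebraic Π₀ over ℚ); partial Hasse
invariants over real quadratic fields
(doi:10.1090/memo/0819; ramified 2: arXiv:1405.6349).

Novelty: Searches (2026-08-15; local searchd DOWN (connection reset), OpenAlex 429 quota, galaxyd saturated >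
90 s — recorded for the refuter;
zbMATH cascade worked): `lit search --source zbmath` × 10: "even Galois representations
Fontaine-Mazur conjecture" (3: Calegari 2011
arXiv:0907.3427, Skinner–Wiles 1999, Hajir–Maire), "multiplicity one SL(2) Ramakrishnan
Rankin-Selberg modularity" (1: doi:10.2307/2661379),
"rigidity p-adic cohomology classes congruence subgroups GL(n) Ash Pollack Stevens" (1:
doi:10.1112/plms/pdm048), "patching completed
homology locally symmetric spaces" (1: arXiv:1609.06965), "even icosahedral Galois representations
prime conductor" (1:
doi:10.1016/j.jnt.2005.08.008), "universal eigenvarieties trianguline" (1: arXiv:1412.1533), "Maass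
forms icosahedral Galois
representations" (4: Michel–Venkatesh 2002, Henniart Bourbaki 1989, DFI 2002,
Booker–Lee–Strömbergsson 2020), "modularity solvable Artin
representations GO(4) type" (1: doi:10.1155/s1073792802000016, READ: Thm A, Cor B, Prop 7.9 descent
criterion pp. 2–3, 21), "Calegari Mazur
nearly ordinary deformations imaginary quadratic even" (1: arXiv:0708.2451), "even Artin
representation tensor product dihedral strong
Artin GL(4)" (0); `lit frontier Langlands --since 2020` (30 rows; nearest: arXiv:2605.03519
infinitesimal characters of completed
cohomology of GL_n over CM fields, arXiv:2603.19768 irreducibility for GL(4) — neither treats even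
Artin input); card-level searches of
the ideate planner and the refuter  [refs: 10.2307/2661379, 10.1112/plms/pdm048, 10.1016/j.jnt.2005.08.008, 10.1155/s1073792802000016, 10.1090/s0894-0347-2011-00721-2, 0907.3427, 1609.06965, 1412.1533, 0708.2451, 2605.03519, 2603.19768, doi:10.2307/2661379, doi:10.1112/plms/pdm048, doi:10.1016/j.jnt.2005.08.008, doi:10.1155/s1073792802000016, doi:10.1090/s0894-0347-2011-00721-2]

Barriers (technique_class: completed-cohomology patching automorphic-induction descent): - technique_class: completed-cohomology patching automorphic-induction descent
- Literature.Barriers.Langlands.NonRegularWeightBarrier: NOT evaded for ArtinLimitClassicalityGL4 —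
that crux IS this barrier's residue (weight −ρ, degenerate limits of discrete series, no
Betti/coherent realisation), stated honestly as one archimedean statement over ℚ; evaded for
TwoAdicProAutomorphyGL4 and ResidualDoorMod2, whose automorphic input lives in REGULAR weight
(AI(g), HT {0,1,k,k+1}) and whose receptacle (completed cohomology / 2-adic limits) is insensitive
to Hodge–Tate multiplicity.
- Literature.Barriers.Langlands.TaylorWilesNumericalCoincidence: applies (n = 4 ≥ 3, l₀ = 1): no
single-degree Taylor–Wiles–Kisin patching; the bet is Calegari–Geraghty / 10-author patching of
completed homology in degrees [4,5] (CalegariGeraghty2017; arXiv:1609.06965) — inside the technique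
class, flagged.
- Literature.Barriers.Langlands.TaylorWilesNumericalCoincidenceNarrow: R itself IS totally-odd
polarisable (symplectic, multiplier parity −1), so the narrow barrier does not bite on R — but every
regular residual lift of R̄₂ is non-polarisable or GO₄-odd, so polarised (CHT/BLGGT) patching cannot
connect them to R: the crux deliberately works unpolarised; conceded.
- Literature.Barriers.Langlands.PatchingLocalComponentBarrier: moot at infinite level — C1 asks for
faithfulness over the FULL local deformation ring at 2 (no weight, no component); the bet is Zariski
density of regular crystalline points (ar

History (route lifecycle, newest last):
- 2026-08-23T09:25:19Z · DORMANT — reconciler: no traction for 6 d (last activity item-evidence-added at 2026-08-17T07:57:36Z); parked, not closed — `ledger route dormant route-Langlands-EvenArti (operator:999:1557249)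
- 2026-08-29T09:41:21Z · REACTIVATED — reconciler: reactivated — activity statement-checked at 2026-08-29T08:15:59Z after parking at 2026-08-23T09:25:19Z (operator:999:3713914)
- 2026-09-03T10:52:54Z · DORMANT — reconciler: no traction for 5 d (last activity statement-checked at 2026-08-29T09:42:52Z); parked, not closed — `ledger route dormant route-Langlands-EvenArtinG (operator:999:903929)

sub-problem: Langlands · status: dormant · opened planner-plancard-Langlands-Langlands-even-art-cb293527-0 2026-08-15T11:09:21Z · rev 2 · ledger route-Langlands-EvenArtinGL4Door
GENERATED by the gate from the ledger (D-0016/17). Provers cite these decls: `theorem foo : Summit.Langlands.Langlands.Theses.EvenArtinGL4Door.<Decl> := …` in Summits/Langlands/Langlands/Theorems/<Name>.lean.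
-/

namespace Summit.Langlands.Langlands.Theses.EvenArtinGL4Door

open scoped BigOperators Topology Manifold Classical MeasureTheory ProbabilityTheory Matrix InnerProductSpace ComplexConjugate ContinuousMap
open Filter Set Function TopologicalSpace MeasureTheory

attribute [summit_statement] _root_.Langlands

/-- item stmt-Langlands-2903 · target · rank 0 · open · by planner
why it might fail: False only if Langlands (B) fails for an even icosahedral ρ/ℚ. No engine: insoluble image (no BC/AI tower), det ρ(c)=+1 (no weight-1/coherent door), Maass λ=1/4 (no Betti cohomology); the converse-theorem route needs holomorphy of all twists (Booker2003). Calegari2023 §12: 'no progress'.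
sources: Calegari2023, BuzzardGeeLMS2014, Gelbart1997, DoudMoore2006, Booker2003, Literature.NumberTheory.Automorphic.booker_strongArtin_of_artinConjecture
[target] strong Artin in Tunnell's a.e. sense for every irreducible even icosahedral ρ : Γ_ℚ →
GL₂(ℂ): ∃ cuspidal π on GL₂(𝔸_ℚ) with `IsPiOfArtinRep ρ π`. -/
@[route_item "route-Langlands-EvenArtinGL4Door"]
def EvenIcosahedralStrongArtin : Prop :=
  ∀ ρ : Literature.NumberTheory.GaloisRepresentations.FramedGaloisRep ℚ ℂ 2, ρ.toGaloisRep.IsIrreducible → Nonempty ((Matrix.ProjGenLinGroup.mk.comp ρ.toMonoidHom).range ≃* alternatingGroup (Fin 5)) → (∀ (φ : ℚ →+* ℝ) (c : Field.absoluteGaloisGroup ℚ), Literature.NumberTheory.GaloisRepresentations.IsComplexConjugation φ c → Matrix.GeneralLinearGroup.det (ρ c) = 1) → ∃ (hcpt : Literature.NumberTheory.Automorphic.isCompact_glFiniteIntegralLevel 2 ℚ) (π : Literature.NumberTheory.Automorphic.CuspidalAutomorphicRepData 2 ℚ hcpt), (∀ᶠ v : IsDedekindDomain.HeightOneSpectrum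 (NumberField.RingOfIntegers ℚ) in Filter.cofinite, ∃ α : Multiset ℂ, π.1.HasSatakeParamAt v α ∧ ρ.IsUnramifiedAt v ∧ ρ.HasFrobCharpolyAt v (Literature.NumberTheory.Automorphic.satakePolynomial α))

/-- item stmt-Langlands-2904 · crux · rank 2 · open · by planner
why it might fail: l₀(GL₄/ℚ)=1: unpolarised R=T_m only conditional (GeeNewton2020); p=2 adequacy of im R̄₂≅SL₂(F₄)⊗dihedral unverified; regular classical points conjecturally rigid off self-dual loci (AshPollackStevens2007, CalegariMazur2008), so Π_s→x_R needs a GSp₄ family, i.e. residual GSp₄-automorphy no one has.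
sources: GeeNewton2020, HansenUniversalEigenvarieties2017, CalegariGeraghty2017, AshPollackStevens2007, CalegariMazur2008, JohanssonNewton2019
[crux] (card crux α, typed as its characteristic-0 shadow) Let ρ : Γ_ℚ → GL₂(ℂ) be irreducible, L
real quadratic with 2 ∤ disc L, ψ : Γ_L → ℂ× of finite order and mixed signature such that no
ψ^(2^a) is the restriction of a character of Γ_ℚ, and R : Γ_ℚ → GL₄(ℂ) a framed model of
Ind_L^ℚ(ρ|_L ⊗ ψ), irreducible. If R is residually automorphic mod 2 in regular weight — some
regular algebraic cuspidal Π₀ of GL₄(𝔸_ℚ) has ι⁻¹(arithmetic-Frobenius polynomial of r_ι(Π₀)) ≡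
ι⁻¹(charpoly R(Frob_v)) coefficientwise modulo the maximal ideal of ℤ̄₂ at almost all v — then R is
a 2-ADIC LIMIT of regular algebraic cuspidal representations: for every s there is a regular
algebraic cuspidal Π_s of GL₄(𝔸_ℚ) with the same congruence to precision 2^(−s) at almost all v.
Informal content: big R^(unpolarised) = T(K^2)_m for GL₄/ℚ at m = m_(R̄₂) (Hansen–Newton Conj. 1.2.3
at this m; Gee–Newton's conditional theorem made unconditional here) + 2-adic accumulation of
regular de Rham points at the Artin point x_R (expected through the ordinary GSp₄ family: R is
symplectic-odd and ordinary at every ℓ ∤ cond R). [difficulty: open-problem] -/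
@[route_item "route-Langlands-EvenArtinGL4Door"]
def TwoAdicProAutomorphyGL4 : Prop :=
  ∀ (ι : PadicAlgCl 2 ≃+* ℂ) (ρ : Literature.NumberTheory.GaloisRepresentations.FramedGaloisRep ℚ ℂ 2) (L : Type) [Field L] [NumberField L] (ψ : Literature.NumberTheory.GaloisRepresentations.FramedGaloisRep L ℂ 1) (R : Literature.NumberTheory.GaloisRepresentations.FramedGaloisRep ℚ ℂ 4), ρ.toGaloisRep.IsIrreducible → Module.finrank ℚ L = 2 → NumberField.IsTotallyReal L → ¬ (2 : ℤ) ∣ NumberField.discr L → (∃ (φ₁ φ₂ : L →+* ℝ) (c₁ c₂ : Field.absoluteGaloisGroup L), Literature.NumberTheory.GaloisRepresentations.IsComplexConjugation φ₁ c₁ ∧ Literature.NumberTheory.GaloisRepresentations.IsComplexConjugation φ₂ c₂ ∧ ψ c₁ ≠ ψ c₂) ∧ (∀ (a : ℕ) (χ : Literature.NumberTheory.GaloisRepresentations.FramedGaloisRep ℚ ℂ 1), ∃ g : Field.absoluteGaloisGroup L, (ψ g) ^ (2 ^ a) ≠ χ (Literature.NumberTheory.GaloisRepresentations.absGaloisRestrict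 ℚ L g)) ∧ (∃ σ : Literature.NumberTheory.GaloisRepresentations.FramedGaloisRep L ℂ 2, (∀ g : Field.absoluteGaloisGroup L, ((σ g : Matrix.GeneralLinearGroup (Fin 2) ℂ) : Matrix (Fin 2) (Fin 2) ℂ) = ((ψ g : Matrix.GeneralLinearGroup (Fin 1) ℂ) : Matrix (Fin 1) (Fin 1) ℂ) 0 0 • ((Literature.NumberTheory.GaloisRepresentations.FramedGaloisRep.restrictField L ρ g : Matrix.GeneralLinearGroup (Fin 2) ℂ) : Matrix (Fin 2) (Fin 2) ℂ)) ∧ Nonempty (R.toGaloisRep.toRepresentation.Equiv (Representation.ind (Literature.NumberTheory.GaloisRepresentations.absGaloisRestrict ℚ L).toMonoidHom σ.toGaloisRep.toRepresentation))) → R.toGaloisRep.IsIrreducible → (∃ (hcpt : Literature.NumberTheory.Automorphic.isCompact_glFiniteIntegralLevel 4 ℚ) (π₀ : Literature.NumberTheory.Automorphic.CuspidalAutomorphicRepData 4 ℚ hcpt), π₀.1.IsRegularAlgebraic ∧ (∀ᶠ v : IsDedekindDomain.HeightOneSpectrum (NumberField.RingOfIntegers ℚ) in Filter.cofinite, ∃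 (α : Multiset ℂ) (P : Polynomial ℂ), π₀.1.HasSatakeParamAt v α ∧ R.IsUnramifiedAt v ∧ R.HasFrobCharpolyAt v P ∧ ∀ i : ℕ, ‖(P.map (ι.symm : ℂ →+* PadicAlgCl 2)).coeff i - (Literature.NumberTheory.Automorphic.arithFrobPolyOfSatake ι v.residueCard 4 α).coeff i‖ < 1)) → (∀ s : ℕ, ∃ (hcpt : Literature.NumberTheory.Automorphic.isCompact_glFiniteIntegralLevel 4 ℚ) (π : Literature.NumberTheory.Automorphic.CuspidalAutomorphicRepData 4 ℚ hcpt), π.1.IsRegularAlgebraic ∧ (∀ᶠ v : IsDedekindDomain.HeightOneSpectrum (NumberField.RingOfIntegers ℚ) in Filter.cofinite, ∃ (α : Multiset ℂ) (P : Polynomial ℂ), π.1.HasSatakeParamAt v α ∧ R.IsUnramifiedAt v ∧ R.HasFrobCharpolyAt v P ∧ ∀ i : ℕ, ‖(P.map (ι.symm : ℂ →+* PadicAlgCl 2)).coeff i - (Literature.NumberTheory.Automorphic.arithFrobPolyOfSatake ι v.residueCard 4 α).coeff i‖ ≤ (1 / 2 : ℝ) ^ s))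

/-- item stmt-Langlands-2905 · crux · rank 3 · open · by planner
why it might fail: HT (0,0,0,0) = weight −ρ: Π_∞ is a totally degenerate limit of discrete series (GL₄/GSp₄/U(2,2)); such π_f lie in no Shimura cohomology, coherent or étale (Mirković; Goldring §4.4.1), only in non-algebraic Griffiths–Schmid cohomology (Carayol1998); no p-adic classicality tool; true only via FM–L.
sources: FontaineMazurGeometric1995, BuzzardGeeLMS2014, Calegari2023, Carayol1998, CarayolKnapp2007, doi:10.2307/2007066
[crux] (card crux β: archimedean realisation at weight −ρ) every irreducible Artin representation R
: Γ_ℚ → GL₄(ℂ) that is a 2-adic limit of regular algebraic cuspidal representations of GL₄(𝔸_ℚ) (in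
the sense of crux 2) corresponds a.e. to an L-algebraic cuspidal automorphic representation Π of
GL₄(𝔸_ℚ): `IsPiOfArtinRep R Π`. A special case of Fontaine–Mazur–Langlands for n = 4 with the extra
hypothesis 'pro-automorphic'; the expected Π_∞ is tempered with parameter 1⊕1⊕sgn⊕sgn (infinitesimal
character 0). [deps: TwoAdicProAutomorphyGL4] [difficulty: open-problem] -/
@[route_item "route-Langlands-EvenArtinGL4Door"]
def ArtinLimitClassicalityGL4 : Prop :=
  ∀ (ι : PadicAlgCl 2 ≃+* ℂ) (R : Literature.NumberTheory.GaloisRepresentations.FramedGaloisRep ℚ ℂ 4), R.toGaloisRep.IsIrreducible → (∀ s : ℕ, ∃ (hcpt : Literature.NumberTheory.Automorphic.isCompact_glFiniteIntegralLevel 4 ℚ) (π : Literature.NumberTheory.Automorphic.CuspidalAutomorphicRepData 4 ℚ hcpt), π.1.IsRegularAlgebraic ∧ (∀ᶠ v : IsDedekindDomain.HeightOneSpectrum (NumberField.RingOfIntegers ℚ) in Filter.cofinite, ∃ (α : Multiset ℂ) (P : Polynomial ℂ), π.1.HasSatakeParamAt v α ∧ R.IsUnramifiedAt v ∧ R.HasFrobCharpolyAt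 v P ∧ ∀ i : ℕ, ‖(P.map (ι.symm : ℂ →+* PadicAlgCl 2)).coeff i - (Literature.NumberTheory.Automorphic.arithFrobPolyOfSatake ι v.residueCard 4 α).coeff i‖ ≤ (1 / 2 : ℝ) ^ s)) → ∃ (hcpt : Literature.NumberTheory.Automorphic.isCompact_glFiniteIntegralLevel 4 ℚ) (π : Literature.NumberTheory.Automorphic.CuspidalAutomorphicRepData 4 ℚ hcpt), π.1.IsLAlgebraic ∧ (∀ᶠ v : IsDedekindDomain.HeightOneSpectrum (NumberField.RingOfIntegers ℚ) in Filter.cofinite, ∃ α : Multiset ℂ, π.1.HasSatakeParamAt v α ∧ R.IsUnramifiedAt v ∧ R.HasFrobCharpolyAt v (Literature.NumberTheory.Automorphic.satakePolynomial α))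

/-- item stmt-Langlands-2906 · crux · rank 4 · open · by planner
why it might fail: Not in print. One door gives π^(L) matching ρ only up to signs ε_p (free at inert p; flipped at split p with ψ^{τ−1}(Frob)=−1); ψ_L is existential in the hypothesis; multi-door patching via ad π^(L) ≅ ad π^(L′) ⇒ twist (Ramakrishnan2000 Thm 4.1.2) must force ONE global quadratic character—may fail.
sources: ArthurClozelAMS120, Ramakrishnan2000, Ramakrishnan2002, Ramakrishnan1994, GelbartJacquet1978, JacquetShalikaAJM1981
[crux] (card bookkeeping δ, upgraded) Let ρ be irreducible of icosahedral type. Suppose that for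
EVERY real quadratic L with 2 ∤ disc L there are ψ (finite order, mixed signature, no ψ^(2^a)
descending to ℚ), a framed model R of Ind_L^ℚ(ρ|_L ⊗ ψ) and a cuspidal Π on GL₄(𝔸_ℚ) with
`IsPiOfArtinRep R Π`. Then ∃ cuspidal π on GL₂(𝔸_ℚ) with `IsPiOfArtinRep ρ π`. Sketch: Π ≅ Π ⊗ χ_L
(SMO) ⇒ Π = AI(Π_L) (AC 4.2(b)); the Rankin–Selberg L-function of BC_L(Π) against BC_L(Π) ⊗ ψ^(1−τ)
has Galois-side pole order exactly 1 (Artin: ord_(s=1) = −mult(1); needs ψ² not from ℚ), forcing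
exactly one of Π_L ψ⁻¹, Π_L^τ ψ⁻¹ to be τ-invariant, hence = BC_L(π^(L)) for a cuspidal π^(L) on
GL₂(𝔸_ℚ) (AC 4.2(d)); a priori Sat(π^(L)_p) = eigenvalues of ρ(Frob_p) only up to signs (common
signs at split p, independent at inert p); ω_(π^(L)) = det ρ is forced by Rankin–Selberg
orthogonality for Sym² π^(L) (Chebotarev average of |a²+b²+ab ξ(p)|² is 3 for an impostor ξ ≠ 1
versus the mandatory 1), so all sign defects are common and ad(π^(L)) ↔ ad⁰ρ EXACTLY
(Gelbart–Jacquet, SMO on GL₃); hence all π^(L) are twists of one π₀ (Ramakrishnan SL(2) multiplicity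
one); the sign defect of π₀ is then constant on the inert p -/
@[route_item "route-Langlands-EvenArtinGL4Door"]
def RealQuadraticDoorDescent : Prop :=
  ∀ ρ : Literature.NumberTheory.GaloisRepresentations.FramedGaloisRep ℚ ℂ 2, ρ.toGaloisRep.IsIrreducible → Nonempty ((Matrix.ProjGenLinGroup.mk.comp ρ.toMonoidHom).range ≃* alternatingGroup (Fin 5)) → (∀ (L : Type) [Field L] [NumberField L], Module.finrank ℚ L = 2 → NumberField.IsTotallyReal L → ¬ (2 : ℤ) ∣ NumberField.discr L → ∃ (ψ : Literature.NumberTheory.GaloisRepresentations.FramedGaloisRep L ℂ 1) (R : Literature.NumberTheory.GaloisRepresentations.FramedGaloisRep ℚ ℂ 4), ((∃ (φ₁ φ₂ : L →+* ℝ) (c₁ c₂ : Field.absoluteGaloisGroup L), Literature.NumberTheory.GaloisRepresentations.IsComplexConjugation φ₁ c₁ ∧ Literature.NumberTheory.GaloisRepresentations.IsComplexConjugation φ₂ c₂ ∧ ψ c₁ ≠ ψ c₂) ∧ (∀ (a : ℕ) (χ : Literature.NumberTheory.GaloisRepresentations.FramedGaloisRep ℚ ℂ 1), ∃ g : Field.absoluteGaloisGroup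 L, (ψ g) ^ (2 ^ a) ≠ χ (Literature.NumberTheory.GaloisRepresentations.absGaloisRestrict ℚ L g)) ∧ (∃ σ : Literature.NumberTheory.GaloisRepresentations.FramedGaloisRep L ℂ 2, (∀ g : Field.absoluteGaloisGroup L, ((σ g : Matrix.GeneralLinearGroup (Fin 2) ℂ) : Matrix (Fin 2) (Fin 2) ℂ) = ((ψ g : Matrix.GeneralLinearGroup (Fin 1) ℂ) : Matrix (Fin 1) (Fin 1) ℂ) 0 0 • ((Literature.NumberTheory.GaloisRepresentations.FramedGaloisRep.restrictField L ρ g : Matrix.GeneralLinearGroup (Fin 2) ℂ) : Matrix (Fin 2) (Fin 2) ℂ)) ∧ Nonempty (R.toGaloisRep.toRepresentation.Equiv (Representation.ind (Literature.NumberTheory.GaloisRepresentations.absGaloisRestrict ℚ L).toMonoidHom σ.toGaloisRep.toRepresentation)))) ∧ ∃ (hcpt : Literature.NumberTheory.Automorphic.isCompact_glFiniteIntegralLevel 4 ℚ) (π : Literature.NumberTheory.Automorphic.CuspidalAutomorphicRepData 4 ℚ hcpt), (∀ᶠ v : IsDedekindDomain.HeightOneSpectrum (NumberField.RingOfIntegers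 ℚ) in Filter.cofinite, ∃ α : Multiset ℂ, π.1.HasSatakeParamAt v α ∧ R.IsUnramifiedAt v ∧ R.HasFrobCharpolyAt v (Literature.NumberTheory.Automorphic.satakePolynomial α))) → ∃ (hcpt : Literature.NumberTheory.Automorphic.isCompact_glFiniteIntegralLevel 2 ℚ) (π : Literature.NumberTheory.Automorphic.CuspidalAutomorphicRepData 2 ℚ hcpt), (∀ᶠ v : IsDedekindDomain.HeightOneSpectrum (NumberField.RingOfIntegers ℚ) in Filter.cofinite, ∃ α : Multiset ℂ, π.1.HasSatakeParamAt v α ∧ ρ.IsUnramifiedAt v ∧ ρ.HasFrobCharpolyAt v (Literature.NumberTheory.Automorphic.satakePolynomial α))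

/-- item stmt-Langlands-2907 · support · rank 9 · open · by planner
sources: KhareWintenberger2009, doi:10.1007/s00222-009-0207-5, DeligneSerreASENS1974, ArthurClozelAMS120, doi:10.1090/memo/0819, arXiv:1405.6349
[support] (card item γ, the residual engine; theorem-sized) for ρ irreducible icosahedral, every ι :
ℚ̄₂ ≃ ℂ and every real quadratic L with 2 ∤ disc L there are ψ and R as in crux 2 with R
irreducible, tr R(c) = 0 at complex conjugations, and R residually automorphic mod 2 from a REGULAR
algebraic cuspidal Π₀ of GL₄(𝔸_ℚ). Proof plan: f from KW at p = 2 (ρ̄₂ ≅ ρ̄_f, image SL₂(F₄)); ψ =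
ψ_sgn·ψ_odd with ψ_odd of odd order ramified at exactly one of a split pair q = 𝔮𝔮^τ (so ψ̄^τ ≠ ψ̄
and R̄₂ = Ind(ρ̄_f|_L ⊗ ψ̄) is absolutely irreducible by Mackey) and ψ_sgn of mixed signature
(exists for every L: kill unit obstructions with a large modulus); g = characteristic-0 Hilbert
eigenform over L of paritious non-parallel weight (k+2, k), k ≥ 2, congruent mod 2 to BC_L(f) ⊗ ψ
(partial Hasse invariants, 2 unramified in L: Andreatta–Goren; Deligne–Serre lifting); Π₀ :=
AI_L^ℚ(g) is cuspidal (g ≄ g^τ), regular algebraic (HT {0,1,k,k+1}) and r̄_ι(Π₀) ≅ R̄₂. [difficulty: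
L] -/
@[route_item "route-Langlands-EvenArtinGL4Door"]
def ResidualDoorMod2 : Prop :=
  ∀ (ι : PadicAlgCl 2 ≃+* ℂ) (ρ : Literature.NumberTheory.GaloisRepresentations.FramedGaloisRep ℚ ℂ 2), ρ.toGaloisRep.IsIrreducible → Nonempty ((Matrix.ProjGenLinGroup.mk.comp ρ.toMonoidHom).range ≃* alternatingGroup (Fin 5)) → ∀ (L : Type) [Field L] [NumberField L], Module.finrank ℚ L = 2 → NumberField.IsTotallyReal L → ¬ (2 : ℤ) ∣ NumberField.discr L → ∃ (ψ : Literature.NumberTheory.GaloisRepresentations.FramedGaloisRep L ℂ 1) (R : Literature.NumberTheory.GaloisRepresentations.FramedGaloisRep ℚ ℂ 4), ((∃ (φ₁ φ₂ : L →+* ℝ) (c₁ c₂ : Field.absoluteGaloisGroup L), Literature.NumberTheory.GaloisRepresentations.IsComplexConjugation φ₁ c₁ ∧ Literature.NumberTheory.GaloisRepresentations.IsComplexConjugation φ₂ c₂ ∧ ψ c₁ ≠ ψ c₂) ∧ (∀ (a : ℕ) (χ : Literature.NumberTheory.GaloisRepresentations.FramedGaloisRep ℚ ℂ 1), ∃ g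 : Field.absoluteGaloisGroup L, (ψ g) ^ (2 ^ a) ≠ χ (Literature.NumberTheory.GaloisRepresentations.absGaloisRestrict ℚ L g)) ∧ (∃ σ : Literature.NumberTheory.GaloisRepresentations.FramedGaloisRep L ℂ 2, (∀ g : Field.absoluteGaloisGroup L, ((σ g : Matrix.GeneralLinearGroup (Fin 2) ℂ) : Matrix (Fin 2) (Fin 2) ℂ) = ((ψ g : Matrix.GeneralLinearGroup (Fin 1) ℂ) : Matrix (Fin 1) (Fin 1) ℂ) 0 0 • ((Literature.NumberTheory.GaloisRepresentations.FramedGaloisRep.restrictField L ρ g : Matrix.GeneralLinearGroup (Fin 2) ℂ) : Matrix (Fin 2) (Fin 2) ℂ)) ∧ Nonempty (R.toGaloisRep.toRepresentation.Equiv (Representation.ind (Literature.NumberTheory.GaloisRepresentations.absGaloisRestrict ℚ L).toMonoidHom σ.toGaloisRep.toRepresentation)))) ∧ R.toGaloisRep.IsIrreducible ∧ (∀ (φ : ℚ →+* ℝ) (c : Field.absoluteGaloisGroup ℚ), Literature.NumberTheory.GaloisRepresentations.IsComplexConjugation φ c → Matrix.trace ((R c : Matrix.GeneralLinearGroup (Fin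 4) ℂ) : Matrix (Fin 4) (Fin 4) ℂ) = 0) ∧ (∃ (hcpt : Literature.NumberTheory.Automorphic.isCompact_glFiniteIntegralLevel 4 ℚ) (π₀ : Literature.NumberTheory.Automorphic.CuspidalAutomorphicRepData 4 ℚ hcpt), π₀.1.IsRegularAlgebraic ∧ (∀ᶠ v : IsDedekindDomain.HeightOneSpectrum (NumberField.RingOfIntegers ℚ) in Filter.cofinite, ∃ (α : Multiset ℂ) (P : Polynomial ℂ), π₀.1.HasSatakeParamAt v α ∧ R.IsUnramifiedAt v ∧ R.HasFrobCharpolyAt v P ∧ ∀ i : ℕ, ‖(P.map (ι.symm : ℂ →+* PadicAlgCl 2)).coeff i - (Literature.NumberTheory.Automorphic.arithFrobPolyOfSatake ι v.residueCard 4 α).coeff i‖ < 1))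

/-- item stmt-Langlands-2908 · support · rank 9 · open · by planner
sources: BuzzardGeeLMS2014, FontaineMazurGeometric1995
[support] X → Langlands: the rest of the summit (regular / totally-real–CM sectors, other n and F,
direction (A), and the upgrade of the a.e. `IsPiOfArtinRep` to `Corresponds` at every finite place
by local–global compatibility + strong multiplicity one). Not this route's business; filed so that
the Assembly ends in the summit constant; shared junction for every even-Artin card. [difficulty:
open-problem] -/
@[route_item "route-Langlands-EvenArtinGL4Door"]
def EvenArtinJunction : Prop :=
  (∀ ρ : Literature.NumberTheory.GaloisRepresentations.FramedGaloisRep ℚ ℂ 2, ρ.toGaloisRep.IsIrreducible → Nonempty ((Matrix.ProjGenLinGroup.mk.comp ρ.toMonoidHom).range ≃* alternatingGroup (Fin 5)) → (∀ (φ : ℚ →+* ℝ) (c : Field.absoluteGaloisGroup ℚ), Literature.NumberTheory.GaloisRepresentations.IsComplexConjugation φ c → Matrix.GeneralLinearGroup.det (ρ c) = 1) → ∃ (hcpt : Literature.NumberTheory.Automorphic.isCompact_glFiniteIntegralLevel 2 ℚ) (π : Literature.NumberTheory.Automorphic.CuspidalAutomorphicRepData 2 ℚ hcpt), (∀ᶠ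 v : IsDedekindDomain.HeightOneSpectrum (NumberField.RingOfIntegers ℚ) in Filter.cofinite, ∃ α : Multiset ℂ, π.1.HasSatakeParamAt v α ∧ ρ.IsUnramifiedAt v ∧ ρ.HasFrobCharpolyAt v (Literature.NumberTheory.Automorphic.satakePolynomial α))) → _root_.Langlands

/-- item stmt-Langlands-2909 · assembly · rank 1 · open · by planner
sources: BuzzardGeeLMS2014, Gelbart1997
[assembly] ResidualDoorMod2 → TwoAdicProAutomorphyGL4 → ArtinLimitClassicalityGL4 →
RealQuadraticDoorDescent → EvenArtinJunction → Langlands. -/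
@[route_item "route-Langlands-EvenArtinGL4Door"]
def Assembly : Prop :=
  ResidualDoorMod2 → TwoAdicProAutomorphyGL4 → ArtinLimitClassicalityGL4 → RealQuadraticDoorDescent → EvenArtinJunction → _root_.Langlands

/-! D-0027 §2.1 — DECIDING THEOREM (planner-authored via `route open/edit --closes-file`; by planner-rbadge-Langlands-EvenArtinGL4Door-df950786-g4-0 2026-08-15T16:14:45Z):
its hypotheses are this route's items and its conclusion the sub-problem Statement (glue_lint), and it elaborates with this file. -/

@[closes "route-Langlands-EvenArtinGL4Door"] theorem closes (hγ : ResidualDoorMod2) (hα : TwoAdicProAutomorphyGL4) (hβ : ArtinLimitClassicalityGL4)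
    (hδ : RealQuadraticDoorDescent) (hJ : EvenArtinJunction) : _root_.Langlands := by
  -- an abstract field isomorphism ι : ℚ̄₂ ≃+* ℂ (both algebraically closed, char 0, cardinality 𝔠)
  obtain ⟨ι⟩ : Nonempty (PadicAlgCl 2 ≃+* ℂ) := by
    have hQ : Cardinal.mk ℚ_[2] = Cardinal.continuum := by
      apply le_antisymm
      · have hsurj : Function.Surjective (Padic.mk : PadicSeq 2 → ℚ_[2]) :=
          fun x ↦ Quotient.inductionOn' x fun a ↦ ⟨a, rfl⟩
        calc Cardinal.mk ℚ_[2] ≤ Cardinal.mk (PadicSeq 2) := Cardinal.mk_le_of_surjective hsurj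
          _ ≤ Cardinal.mk (ℕ → ℚ) := Cardinal.mk_subtype_le _
          _ = Cardinal.continuum := by
            rw [Cardinal.mk_arrow, Cardinal.mk_eq_aleph0 ℚ, Cardinal.mk_eq_aleph0 ℕ]
            simp [Cardinal.aleph0_power_aleph0]
      · exact continuum_le_cardinal_of_nontriviallyNormedField ℚ_[2]
    have hC : Cardinal.mk (PadicAlgCl 2) = Cardinal.continuum := by
      apply le_antisymm
      · refine (Algebra.IsAlgebraic.cardinalMk_le_max ℚ_[2] (PadicAlgCl 2)).trans ?_
        rw [hQ, max_eq_left Cardinal.aleph0_le_continuum]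
      · rw [← hQ]
        exact Cardinal.mk_le_of_injective (algebraMap ℚ_[2] (PadicAlgCl 2)).injective
    refine IsAlgClosed.ringEquiv_of_equiv_of_charZero ?_ (Cardinal.eq.1 ?_)
    · rw [hC]; exact Cardinal.aleph0_lt_continuum
    · rw [hC, Cardinal.mk_complex]
  -- the junction reduces the summit to the even icosahedral strong Artin statement, and the
  -- multi-door descent reduces that to one GL₄-door for every admissible real quadratic L
  refine hJ fun ρ hirr hico _heven ↦ hδ ρ hirr hico ?_
  intro L _ _ hdeg hreal hdisc
  -- residual engine: door data (ψ, R), R irreducible, residually automorphic mod 2 in regular weight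
  obtain ⟨ψ, R, hdoor, hRirr, _htr, hres⟩ := hγ ι ρ hirr hico L hdeg hreal hdisc
  -- 2-adic pro-automorphy: R is a 2-adic limit of regular algebraic cuspidal Π_s on GL₄/ℚ
  have hlim := hα ι ρ L ψ R hirr hdeg hreal hdisc hdoor hRirr hres
  -- classicality at weight −ρ: an L-algebraic cuspidal P on GL₄(𝔸_ℚ) with Satake = Frobenius a.e.
  obtain ⟨hcpt, P, _hLalg, hP⟩ := hβ ι R hRirr hlim
  exact ⟨ψ, R, hdoor, hcpt, P, hP⟩

end Summit.Langlands.Langlands.Theses.EvenArtinGL4Door
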